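import Summits.ABC.StewartYu.PadicG3ParA
import Summits.ABC.StewartYu.RecordExitsNumeric
import HarnessLib

/-!
# Cell abc-stewartyu, Gen-3 record (WP-M3.R): exit A of the END is numerically impossible for the
# parameters of `PadicG3Par` — hypothesis `hA` of `RecordAssembly.recordTwo_of_ineqs` discharged

`Summits/ABC/StewartYu/PadicG3Exits.lean` — cell `abc-stewartyu` (HOME `run/shared/lean/pub/abc-stewartyu/`),
route `PadicPrimesKummerThird`, cruxes `Y07Odd` (stmt-ABC-19658) / `Y07Two` (stmt-ABC-19659); seat lp-1 (g2),
record parcel (R2) (plan g8 2026-08-26T23:38:58Z), on p1's parameter record `PadicG3Par` / `PadicG3ParA`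
(p474824 / p475095) and the generic numerics `RecordExitsNumeric` (lp-1).  Theorems only.

The END data of the record are `D₀ = L₀ + 1`, `Dⱼ = ⌊N_q L/(2^Ŝ Aⱼ)⌋ + 1`, `S₀ = ⌊M/(n+2)⁴⌋`,
`X_fin = ⌊2ⁿ X_Ŝ/(n+1)⌋`.  This file proves the two scalar premises of `RecordExitsNumeric.exitA_of_bounds`
for them, with the uniform degree bound `Dmax := ⌊L/2^{n+22}⌋ + 1`:

* `D_le_Dmax` — `Dⱼ ≤ ⌊L/2^{n+22}⌋ + 1` (`2^Ŝ > 2^{n+23} N_q`, `Aⱼ ≥ log 2 > 1/2`);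
* `K1` — `2n(n+1)·Dmax ≤ S₀ + 1` (room `2^{n+24} ≥ n(n+2)⁴`);
* `one_le_X`, `X_mul_two_pow_le_Xs` (`X·2^{Ŝ−2} ≤ X_Ŝ`: the points double at every level while `T_s`
  halves), `X_mul_two_pow_le_Xfin` (`2^{n+22} X ≤ X_fin`);
* `D₀_le` — `D₀ ≤ X L/4 + 2` (`24 Cbⁿ Ω K ≤ L` since `yload ≥ G`);
* `K2` — `(n+1)²·D₀ < (S₀+1)·(2 X_fin + 1)` (room `2^{n+24} ≥ (n+1)(n+2)⁴`; the class count `K` CANCELS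
  between `D₀` and `L`);
* `exitA` — hypothesis `hA` of `RecordAssembly.recordTwo_of_ineqs` / `recordOdd_of_ineqs` for
  `(D₀, S₀, X, Dmax) := (P.D₀, P.S₀N, P.Xfin, ⌊L/2^{n+22}⌋ + 1)`, every `r ≤ n`, `d₀ ≤ 1`.

Exit B (`r = n`) and clause (C) are NOT discharged here: with `Ŝ = n + 24 + ⌊log₂ N_q⌋` they need the
class count `K = p^m K₀` to be `≪ 2^{(n+1)Ŝ}`, which fails for large `p` (STATUS lp-1 2026-08-27T00:2xZ;
the depth must absorb `log₂ K`, as in K-M3-1-ledger-p2 §2).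

WHAT THIS IS NOT: no crux moves; exit A only.

References: Yu. V. Nesterenko, LNM 1819 (2003), §5.2 (5.12)–(5.17), Lemma 5.3.
-/

noncomputable section

open Finset Real

namespace Summit.ABC.StewartYu

namespace PadicG3Par

open Summit.ABC.StewartYu.RecordExitsNumeric

variable {n : ℕ} (P : PadicG3Par n)

/-! ### The uniform degree bound `Dⱼ ≤ ⌊L/2^{n+22}⌋ + 1` -/

/-- `N_q L/(2^Ŝ Aⱼ) < L/2^{n+22}` (real): `2^Ŝ > 2^{n+23} N_q` and `Aⱼ ≥ log 2 > 1/2`.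
[cite: Nesterenko2003, §5.2 (5.17)] -/
theorem Nq_mul_L_div_lt (j : Fin n) :
    (P.Nq : ℝ) * P.L / (2 ^ P.Sdepth * P.A j) < (P.L : ℝ) / 2 ^ (n + 22) := by
  have hA := P.A_pos j
  have hAlog := P.hA j
  have hlog2 : (1 / 2 : ℝ) < Real.log 2 := by have := Real.log_two_gt_d9; linarith
  have hA2 : (1 / 2 : ℝ) < P.A j := lt_of_lt_of_le hlog2 hAlog
  have hS : (2 : ℝ) ^ (n + 24) * P.Nq < 2 * 2 ^ P.Sdepth := by exact_mod_cast P.Nq_lt_two_pow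
  have hL : (0 : ℝ) < P.L := by linarith [P.one_le_L]
  have hNq : (0 : ℝ) < P.Nq := by exact_mod_cast P.hNq
  rw [div_lt_div_iff₀ (by positivity) (by positivity)]
  -- `Nq L 2^{n+22} < L (2^Ŝ A_j)`: from `2^{n+24} Nq < 2·2^Ŝ` and `A_j > 1/2`
  have h1 : (P.Nq : ℝ) * 2 ^ (n + 22) * 4 < 2 * 2 ^ P.Sdepth := by
    have : (2 : ℝ) ^ (n + 24) = 2 ^ (n + 22) * 4 := by ring
    nlinarith
  have h2 : (2 : ℝ) * 2 ^ P.Sdepth * (1 / 2) < 2 ^ P.Sdepth * P.A j * 2 := by nlinarith [pow_pos (two_pos (α := ℝ)) P.Sdepth]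
  nlinarith [pow_pos (two_pos (α := ℝ)) P.Sdepth, pow_pos (two_pos (α := ℝ)) (n + 22)]

/-- **`Dⱼ ≤ ⌊L/2^{n+22}⌋ + 1`** for every `j`. [cite: Nesterenko2003, §5.2 (5.17)] -/
theorem D_le_Dmax (j : Fin n) : P.D j ≤ P.L / 2 ^ (n + 22) + 1 := by
  unfold D
  refine Nat.add_le_add_right ?_ 1
  have h := (P.Nq_mul_L_div_lt j).le
  calc ⌊(P.Nq : ℝ) * P.L / (2 ^ P.Sdepth * P.A j)⌋₊ ≤ ⌊(P.L : ℝ) / 2 ^ (n + 22)⌋₊ := Nat.floor_le_floor h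
    _ = P.L / 2 ^ (n + 22) := by
        rw [show ((2 : ℝ) ^ (n + 22)) = ((2 ^ (n + 22) : ℕ) : ℝ) by push_cast; ring]
        exact Nat.floor_div_eq_div _ _

/-! ### (K1): `2n(n+1)·Dmax ≤ S₀ + 1` -/

/-- `4 ≤ ⌊L/2^{n+22}⌋` (as `2^{n+24} ≤ L`). [folklore] -/
theorem four_le_L_div : 4 ≤ P.L / 2 ^ (n + 22) := by
  rw [Nat.le_div_iff_mul_le (by positivity)]
  calc 4 * 2 ^ (n + 22) = 2 ^ (n + 24) := by ring
    _ ≤ P.L := P.two_pow_le_L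

/-- **(K1)** `2n(n+1)·(⌊L/2^{n+22}⌋ + 1) ≤ S₀ + 1`: each lattice direction of an obstruction subgroup
costs `2n(n+1)Dmax/(S₀+1) ≤ n(n+2)⁴/2^{n+24} ≤ 1`. [cite: Nesterenko2003, §5.2 (5.13)–(5.14)] -/
theorem K1 : 2 * n * (n + 1) * (P.L / 2 ^ (n + 22) + 1) ≤ P.S₀N + 1 := by
  have hq4 := P.four_le_L_div
  have hqL : P.L / 2 ^ (n + 22) * 2 ^ (n + 22) ≤ P.L := Nat.div_mul_le_self _ _
  have hpoly := mul_pow_four_le_two_pow n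
  -- `2n(n+1)(q+1)(n+2)^4 ≤ 4 n (n+1) q (n+2)^4 ≤ (n+1) q 2^{n+26} = 16 (n+1) (q 2^{n+22}) ≤ 16 (n+1) L = M`
  have hmain : 2 * n * (n + 1) * (P.L / 2 ^ (n + 22) + 1) * (n + 2) ^ 4 ≤ P.M := by
    rw [P.M_eq]
    generalize P.L / 2 ^ (n + 22) = q at hq4 hqL ⊢
    calc 2 * n * (n + 1) * (q + 1) * (n + 2) ^ 4
        ≤ 2 * n * (n + 1) * (2 * q) * (n + 2) ^ 4 := by gcongr; omega
      _ = 4 * (n + 1) * q * (n * (n + 2) ^ 4) := by ring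
      _ ≤ 4 * (n + 1) * q * 2 ^ (n + 24) := Nat.mul_le_mul_left _ hpoly
      _ = 16 * (n + 1) * (q * 2 ^ (n + 22)) := by ring
      _ ≤ 16 * (n + 1) * P.L := Nat.mul_le_mul_left _ hqL
  have h4 : 0 < (n + 2) ^ 4 := Nat.pow_pos (by omega)
  have h : 2 * n * (n + 1) * (P.L / 2 ^ (n + 22) + 1) ≤ P.S₀N := by
    show _ ≤ P.M / (n + 2) ^ 4
    exact (Nat.le_div_iff_mul_le h4).mpr hmain
  exact h.trans (Nat.le_succ _)

/-! ### The points: `1 ≤ X`, `X·2^{Ŝ−2} ≤ X_Ŝ ≤ X_fin` -/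

/-- `0 < W_L`. [folklore] -/
theorem WL_pos : 0 < P.WL := by
  unfold WL
  apply Real.log_pos
  have he : 1 < Real.exp 1 := by have := Real.exp_one_gt_d9; linarith
  have hL : (0 : ℝ) ≤ P.L := by positivity
  have h1 : (1 : ℝ) ≤ 1 + 2 * Real.exp P.W * P.L := by
    have := Real.exp_pos P.W; nlinarith
  calc (1 : ℝ) < Real.exp 1 * 1 := by linarith
    _ ≤ Real.exp 1 * (1 + 2 * Real.exp P.W * P.L) :=
        mul_le_mul_of_nonneg_left h1 (Real.exp_pos 1).le

/-- **`1 ≤ X`**. [folklore] -/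
theorem one_le_X : 1 ≤ P.X := by
  unfold X
  refine le_trans ?_ (le_max_left _ _)
  rw [Nat.one_le_iff_ne_zero, Ne, Nat.ceil_eq_zero, not_le]
  have := P.WL_pos; have := P.eight_le_G
  positivity

/-- **`X · 2^{Ŝ−2} ≤ X_Ŝ`**: at the END depth the number of points has grown by `2^{Ŝ−2}`
(`2^Ŝ (T_Ŝ + 1) ≤ 16 L`). [cite: Nesterenko2003, §5.2 (5.12)] -/
theorem X_mul_two_pow_le_Xs : P.X * 2 ^ (P.Sdepth - 2) ≤ P.Xs P.Sdepth := by
  unfold Xs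
  rw [Nat.le_div_iff_mul_le (by positivity)]
  have hT := P.two_pow_mul_T_le P.Sdepth
  have hT1 : 1 ≤ P.T P.Sdepth := P.one_le_T _ (by omega)
  have hS2 : 2 ≤ P.Sdepth := by unfold Sdepth; omega
  have e : 2 ^ P.Sdepth = 2 ^ (P.Sdepth - 2) * 4 := by
    rw [show (4 : ℕ) = 2 ^ 2 by norm_num, ← pow_add, Nat.sub_add_cancel hS2]
  -- `2^{Ŝ-2} (T+1) · 4 = 2^Ŝ (T+1) ≤ 2^Ŝ · 2T ≤ 16 L`
  have h1 : 2 ^ (P.Sdepth - 2) * (P.T P.Sdepth + 1) * 4 ≤ 16 * P.L := by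
    calc 2 ^ (P.Sdepth - 2) * (P.T P.Sdepth + 1) * 4 = 2 ^ P.Sdepth * (P.T P.Sdepth + 1) := by
          rw [e]; ring
      _ ≤ 2 ^ P.Sdepth * (2 * P.T P.Sdepth) := Nat.mul_le_mul_left _ (by omega)
      _ = 2 * (2 ^ P.Sdepth * P.T P.Sdepth) := by ring
      _ ≤ 2 * (8 * P.L) := Nat.mul_le_mul_left _ hT
      _ = 16 * P.L := by ring
  calc P.X * 2 ^ (P.Sdepth - 2) * (P.T P.Sdepth + 1) = P.X * (2 ^ (P.Sdepth - 2) * (P.T P.Sdepth + 1)) := by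
        ring
    _ ≤ P.X * (4 * P.L) := Nat.mul_le_mul_left _ (by omega)
    _ = 4 * P.X * P.L := by ring

/-- `X_Ŝ ≤ X_fin` (`2ⁿ ≥ n + 1`). [folklore] -/
theorem Xs_le_Xfin : P.Xs P.Sdepth ≤ P.Xfin := by
  unfold Xfin
  rw [Nat.le_div_iff_mul_le (by positivity), mul_comm]
  exact Nat.mul_le_mul_right _ (Nat.succ_le_of_lt Nat.lt_two_pow_self)

/-- **`2^{n+22} · X ≤ X_fin`**. [cite: Nesterenko2003, §5.2 (5.12)] -/
theorem X_mul_two_pow_le_Xfin : 2 ^ (n + 22) * P.X ≤ P.Xfin := by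
  have hS : n + 22 ≤ P.Sdepth - 2 := by unfold Sdepth; omega
  calc 2 ^ (n + 22) * P.X ≤ 2 ^ (P.Sdepth - 2) * P.X :=
        Nat.mul_le_mul_right _ (Nat.pow_le_pow_right (by norm_num) hS)
    _ = P.X * 2 ^ (P.Sdepth - 2) := mul_comm _ _
    _ ≤ P.Xs P.Sdepth := P.X_mul_two_pow_le_Xs
    _ ≤ P.Xfin := P.Xs_le_Xfin

/-- `1 ≤ X_fin`. [folklore] -/
theorem one_le_Xfin : 1 ≤ P.Xfin :=
  le_trans (by have := P.one_le_X; have : 1 ≤ 2 ^ (n + 22) := Nat.one_le_two_pow; nlinarith)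
    P.X_mul_two_pow_le_Xfin

/-! ### (K2): `(n+1)²·D₀ < (S₀+1)·(2X_fin+1)` -/

/-- `G ≤ yload`. [folklore] -/
theorem G_le_yload : P.G ≤ P.yload := by
  unfold yload
  have h1 : 0 ≤ Real.log P.p := P.log_p_pos.le
  have h2 : 0 ≤ ((P.Sdepth : ℝ) + n + 1) * Real.log 2 := by
    have := Real.log_two_gt_d9; positivity
  have h3 : 0 ≤ Real.log (n + 1) := Real.log_nonneg (by linarith [(Nat.cast_nonneg n : (0:ℝ) ≤ n)])
  linarith

/-- **`24 Cbⁿ Ω K ≤ L`** (the Siegel term of `L`, using `yload ≥ G`). [folklore] -/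
theorem main_le_L' : 24 * Cb ^ n * P.Ω * P.K ≤ P.L := by
  have h := P.main_le_L
  have hG : 0 < P.G := by linarith [P.eight_le_G]
  have hy : 1 ≤ P.yload / P.G := by rw [le_div_iff₀ hG, one_mul]; exact P.G_le_yload
  have hpos : 0 ≤ 24 * Cb ^ n * P.Ω * P.K := by
    have := P.Ω_pos; have := P.K_pos; have : (0:ℝ) < Cb := by unfold Cb cM; positivity
    positivity
  calc 24 * Cb ^ n * P.Ω * P.K = 24 * Cb ^ n * P.Ω * P.K * 1 := (mul_one _).symm
    _ ≤ 24 * Cb ^ n * P.Ω * P.K * (P.yload / P.G) := mul_le_mul_of_nonneg_left hy hpos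
    _ = 24 * Cb ^ n * P.Ω * P.K * P.yload / P.G := by ring
    _ ≤ P.L := h

/-- **`D₀ ≤ X L/4 + 2`**. [cite: Nesterenko2003, §5.2 (5.16)] -/
theorem D₀_le : (P.D₀ : ℝ) ≤ (P.X : ℝ) * P.L / 4 + 2 := by
  unfold D₀ L₀
  push_cast
  have hpos : 0 ≤ 6 * (P.X : ℝ) * Cb ^ n * P.Ω * P.K := by
    have := P.Ω_pos; have := P.K_pos; have : (0:ℝ) < Cb := by unfold Cb cM; positivity
    positivity
  have hceil := (Nat.ceil_lt_add_one hpos).le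
  have hmain := P.main_le_L'
  have hX : (0 : ℝ) ≤ P.X := by positivity
  have : 6 * (P.X : ℝ) * Cb ^ n * P.Ω * P.K ≤ P.X * P.L / 4 := by
    have : 6 * (P.X : ℝ) * Cb ^ n * P.Ω * P.K = P.X * (24 * Cb ^ n * P.Ω * P.K) / 4 := by ring
    rw [this]
    exact div_le_div_of_nonneg_right (mul_le_mul_of_nonneg_left hmain hX) (by norm_num)
  linarith

/-- `16 (n+1) L < (S₀ + 1)(n+2)⁴` (the floor in `S₀ = ⌊M/(n+2)⁴⌋` loses less than one unit).
[cite: Nesterenko2003, §5.2 (5.8)] -/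
theorem M_lt_S₀N_succ_mul : 16 * (n + 1) * P.L < (P.S₀N + 1) * (n + 2) ^ 4 := by
  rw [← P.M_eq]
  unfold S₀N
  have h := Nat.lt_div_mul_add (a := P.M) (b := (n + 2) ^ 4) (by positivity)
  calc P.M < P.M / (n + 2) ^ 4 * (n + 2) ^ 4 + (n + 2) ^ 4 := h
    _ = (P.M / (n + 2) ^ 4 + 1) * (n + 2) ^ 4 := by ring

/-- **(K2)** `(n+1)²·D₀ < (S₀+1)·(2X_fin+1)`: the additive direction costs
`(n+1)² D₀/((S₀+1)(2X_fin+1)) ≤ (n+1)(n+2)⁴/2^{n+28} < 1` — the class count `K` cancels between `D₀`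
and `L`. [cite: Nesterenko2003, §5.2 Lemma 5.3 (5.15)–(5.16)] -/
theorem K2 : (n + 1) ^ 2 * P.D₀ < (P.S₀N + 1) * (2 * P.Xfin + 1) := by
  have hpoly : ((n + 1 : ℕ) : ℝ) * ((n + 2 : ℕ) : ℝ) ^ 4 ≤ (2 : ℝ) ^ (n + 24) := by
    exact_mod_cast succ_mul_pow_four_le_two_pow n
  have hS : (16 : ℝ) * (n + 1) * P.L < (P.S₀N + 1) * ((n + 2 : ℕ) : ℝ) ^ 4 := by
    exact_mod_cast P.M_lt_S₀N_succ_mul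
  have hXf : (2 : ℝ) ^ (n + 22) * P.X ≤ P.Xfin := by exact_mod_cast P.X_mul_two_pow_le_Xfin
  have hX1 : (1 : ℝ) ≤ P.X := by exact_mod_cast P.one_le_X
  have hL : (2 : ℝ) ^ (n + 24) ≤ P.L := by exact_mod_cast P.two_pow_le_L
  have hD₀ := P.D₀_le
  have h224 : (2 : ℝ) ^ 24 ≤ 2 ^ (n + 24) := pow_le_pow_right₀ (by norm_num) (by omega)
  have hXL : (2 : ℝ) ^ 24 ≤ (P.X : ℝ) * P.L := by nlinarith
  -- `D₀ ≤ XL/4 + 2 ≤ XL/2`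
  have hD₀' : (P.D₀ : ℝ) ≤ (P.X : ℝ) * P.L / 2 := by nlinarith
  have hn1 : (1 : ℝ) ≤ ((n + 1 : ℕ) : ℝ) := by exact_mod_cast Nat.succ_pos n
  have hn2 : (0 : ℝ) < ((n + 2 : ℕ) : ℝ) ^ 4 := by positivity
  -- work in `ℝ`
  have key : ((n + 1 : ℕ) : ℝ) ^ 2 * P.D₀ < (P.S₀N + 1) * (2 * P.Xfin + 1) := by
    -- `(n+1)^2 D₀ (n+2)^4 ≤ (n+1) 2^{n+24} · XL/2 = (n+1) L · 2^{n+23} X < 16(n+1)L · 2^{n+23}X/16 ...`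
    have h1 : ((n + 1 : ℕ) : ℝ) ^ 2 * P.D₀ * ((n + 2 : ℕ) : ℝ) ^ 4 ≤
        ((n + 1 : ℕ) : ℝ) * (2 : ℝ) ^ (n + 24) * ((P.X : ℝ) * P.L / 2) := by
      calc ((n + 1 : ℕ) : ℝ) ^ 2 * P.D₀ * ((n + 2 : ℕ) : ℝ) ^ 4
          = ((n + 1 : ℕ) : ℝ) * (((n + 1 : ℕ) : ℝ) * ((n + 2 : ℕ) : ℝ) ^ 4) * P.D₀ := by ring
        _ ≤ ((n + 1 : ℕ) : ℝ) * (2 : ℝ) ^ (n + 24) * ((P.X : ℝ) * P.L / 2) := by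
            have hD0 : (0 : ℝ) ≤ P.D₀ := by positivity
            gcongr
    have h2 : ((n + 1 : ℕ) : ℝ) * (2 : ℝ) ^ (n + 24) * ((P.X : ℝ) * P.L / 2) =
        (16 * (n + 1) * P.L) * (2 ^ (n + 22) * P.X) / 8 := by
      push_cast; rw [pow_add, pow_add]; ring
    have h3 : (16 * ((n : ℝ) + 1) * P.L) * (2 ^ (n + 22) * P.X) <
        ((P.S₀N : ℝ) + 1) * ((n + 2 : ℕ) : ℝ) ^ 4 * P.Xfin := by
      have hpos : (0 : ℝ) < 2 ^ (n + 22) * P.X := by positivity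
      calc (16 * ((n : ℝ) + 1) * P.L) * (2 ^ (n + 22) * P.X)
          < ((P.S₀N : ℝ) + 1) * ((n + 2 : ℕ) : ℝ) ^ 4 * (2 ^ (n + 22) * P.X) :=
            mul_lt_mul_of_pos_right hS hpos
        _ ≤ ((P.S₀N : ℝ) + 1) * ((n + 2 : ℕ) : ℝ) ^ 4 * P.Xfin :=
            mul_le_mul_of_nonneg_left hXf (by positivity)
    have h4 : ((n + 1 : ℕ) : ℝ) ^ 2 * P.D₀ * ((n + 2 : ℕ) : ℝ) ^ 4 <
        (P.S₀N + 1) * (2 * P.Xfin + 1) * ((n + 2 : ℕ) : ℝ) ^ 4 := by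
      have hXf0 : (0 : ℝ) ≤ P.Xfin := by positivity
      have hS0 : (0 : ℝ) ≤ (P.S₀N : ℝ) + 1 := by positivity
      calc ((n + 1 : ℕ) : ℝ) ^ 2 * P.D₀ * ((n + 2 : ℕ) : ℝ) ^ 4
          ≤ (16 * (n + 1) * P.L) * (2 ^ (n + 22) * P.X) / 8 := by rw [← h2]; exact h1
        _ < ((P.S₀N : ℝ) + 1) * ((n + 2 : ℕ) : ℝ) ^ 4 * P.Xfin / 8 := by
            push_cast at h3 ⊢; linarith
        _ ≤ (P.S₀N + 1) * (2 * P.Xfin + 1) * ((n + 2 : ℕ) : ℝ) ^ 4 := by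
            rw [div_le_iff₀ (by norm_num : (0:ℝ) < 8)]
            nlinarith [mul_nonneg hS0 hXf0, mul_nonneg (mul_nonneg hS0 hXf0) hn2.le]
    exact lt_of_mul_lt_mul_right h4 hn2.le
  exact_mod_cast key

/-! ### Exit A discharged -/

/-- **Exit A is impossible for the record's END parameters**: hypothesis `hA` of
`RecordAssembly.recordTwo_of_ineqs` / `recordOdd_of_ineqs` with
`(D₀, S₀, X, Dmax) := (P.D₀, P.S₀N, P.Xfin, ⌊L/2^{n+22}⌋ + 1)` (and `Dⱼ ≤ Dmax` is `D_le_Dmax`).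
[cite: Nesterenko2003, §5.2 Lemma 5.3] -/
theorem exitA : ∀ r d₀ : ℕ, r ≤ n → d₀ ≤ 1 →
    (n + 1).factorial * 2 ^ n * P.D₀ * (P.L / 2 ^ (n + 22) + 1) ^ r <
      Nat.choose (P.S₀N + (r + 1 - d₀)) (r + 1 - d₀) * (2 * P.Xfin + 1) *
        ((d₀ + (n - r)).factorial * 2 ^ (n - r) * P.D₀ ^ d₀) :=
  exitA_of_bounds P.one_le_Xfin (by unfold D₀; omega) P.K1 P.K2

end PadicG3Par

end Summit.ABC.StewartYu

end
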